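import Literature.Topology.FourManifolds.HomotopyS4Criterion
import Literature.Topology.FourManifolds.PuncturedHomotopySphereHomology
import Literature.AlgebraicTopology.Homotopy.WhiteheadContractibleLeaves
import Literature.AlgebraicTopology.Homotopy.PuncturedContractible
import HarnessLib

/-!
# Homotopy 4-spheres (`spc4.S10`), second reduction: puncture, Hurewicz and Milnor's CW type

Sibling of `HomotopyS4Criterion.lean`, which reduces the named fact
`Literature.Topology.FourManifolds.nonempty_homotopyEquiv_sphere_four_iff` (`SPC4Wave0.lean`,
statement id `spc4.S10`; Freedman–Quinn 1990, §10.1; "Hurewicz + Whitehead + Poincaré duality"):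
*a closed topological 4-manifold `M` is homotopy equivalent to `S⁴` iff it is simply connected
with `H₂(M; ℤ) = 0`* — to three named facts: Poincaré duality (Hatcher 2002, Thm. 3.30,
`bijective_poincareDualityMap`), Whitehead's theorem in homology form (Cor. 4.33,
`whitehead_exists_homotopyEquiv`) and the CW homotopy type of closed manifolds (Cor. A.12,
`exists_cwComplex_homotopyEquiv_of_compactSpace`); the direction (⇒) is proved there outright.

This file gives a second, independent reduction of the hard direction (⇐) in which Whitehead's
theorem Cor. 4.33 is replaced by the **absolute Hurewicz theorem** (Hatcher Thm. 4.32, tree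
named fact `Literature.AlgebraicTopology.SingularHomology.hurewicz_iso`) together with the
**Whitehead contractibility criterion, which is PROVED in the tree**
(`Literature.AlgebraicTopology.Homotopy.whitehead_contractibleSpace_holds`,
`WhiteheadCWContractible.lean`), and Cor. A.12 by **Milnor's theorem** that second countable
Hausdorff manifolds have CW homotopy type (Milnor 1959, Cor. 1, tree named fact
`Literature.AlgebraicTopology.Homotopy.Manifold.exists_cwComplex_homotopyEquiv`). These two
leaves are exactly those of the Kervaire–Milnor line "punctured homotopy spheres are
contractible" (`WhiteheadContractibleLeaves.lean`), so that after this file `spc4.S10` needs,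
besides Poincaré duality, only what that line needs.

## The argument (puncture; Hatcher 2002, Example 0.10 / Prop. 0.17, §2.2, Prop. 3.29, Thm. 4.32)

Let `M : Type` be closed, simply connected, with `H₂(M; ℤ) = 0`, and `p ∈ M`.
1. `H₁(M) = 0` (proved), `H₃(M) = 0` (Poincaré duality `H¹ ≅ H₃`, hypothesis `hPD`, with
   `H¹ = 0` proved: `isZero_singularHomology_of_poincareDuality_of_isZero_one`), `Hₖ(M) = 0`
   for `k ≥ 5` and `H₄(M) ≅ ℤ ≠ 0` (fundamental class, degree-one collapse map; proved): `M`
   has the integral homology of `S⁴` (`isZero_singularHomology_of_ne_of_poincareDuality`,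
   `not_isZero_singularHomology_four`).
2. Hence `M ∖ {p}` is acyclic (`isZero_singularHomology_compl_singleton_of_isZero`: the
   Mayer–Vietoris/Bockstein argument of `PuncturedHomotopySphereHomology.lean`, written there for
   smooth homotopy spheres and repeated here VERBATIM for a closed topological manifold with the
   homology of a sphere — only `Hₖ(M) ≅ Hₖ(Sⁿ)` enters) and simply connected (general position,
   `isSimplyConnected_compl_singleton_of_isOpenEmbedding`, proved).
3. By Hurewicz (`h432`) all homotopy groups of `M ∖ {p}` vanish; being an open subset of `M` it
   is a second countable Hausdorff 4-manifold, so it has CW homotopy type (`hCW`) and Whitehead's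
   criterion (proved) makes it contractible (`contractibleSpace_compl_singleton_of_hurewicz`, via
   `Manifold.contractibleSpace_of_simplyConnected_of_acyclic_of_hurewicz_of_cwType`, tree).
4. A Hausdorff space contractible after deleting a point with a Euclidean neighbourhood is
   homotopy equivalent to the sphere (`nonempty_homotopyEquiv_sphere_of_contractibleSpace_compl`,
   `PuncturedContractible.lean`, proved): `nonempty_homotopyEquiv_sphere_four_of_hurewicz`.

Assembly: `nonempty_homotopyEquiv_sphere_four_iff_of_hurewicz` (**`spc4.S10` at universe `0`**)
and `…_of_hurewicz_univ` (every universe, by `nonempty_homotopyEquiv_sphere_four_iff_of_univ_zero`)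
from `hPD` (Thm. 3.30, only `H¹ ≅ H₃` of closed oriented 4-manifolds is consumed), `h432`
(Thm. 4.32) and `hCW` (Milnor 1959 Cor. 1) — the remaining, unproved leaves. No declaration in
this file uses `sorry`; the file declares no definitions.

## References

* M. H. Freedman, F. Quinn, *Topology of 4-manifolds*, Princeton Math. Series 39 (1990), §10.1
  ("`S⁴` and `S² × S²` have even forms, so are uniquely determined by their forms")
  [FreedmanQuinnPMS1990].
* A. Hatcher, *Algebraic Topology*, CUP 2002: Example 0.10, Prop. 0.17, §2.2, Prop. 3.29,
  Thm. 3.30, §4.1 Thm. 4.5 and remark p. 348, Thm. 4.32 [HatcherAT2002].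
* J. Milnor, *On spaces having the homotopy type of a CW-complex*, Trans. AMS 90 (1959) [Milnor1959].
* A. Kosinski, *Differential Manifolds*, Academic Press (1993), Ch. VI §2 [Kosinski1993]. -/

noncomputable section

open CategoryTheory Limits ContinuousMap Set Metric

namespace Literature.Topology.FourManifolds

section Punctured

variable {n : ℕ} {M : Type} [TopologicalSpace M] [T2Space M] [ChartedSpace (EuclideanSpace ℝ (Fin n)) M]

/-- `M ∖ {p}` is connected for a path-connected topological `n`-manifold `M`, `n ≥ 2`
(general position; Hatcher 2002, proof of Prop. 1.14). [folklore] -/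
theorem connectedSpace_compl_singleton_of_chartedSpace [PathConnectedSpace M] (hn : 2 ≤ n)
    (p : M) : ConnectedSpace ↥(({p}ᶜ : Set M)) := by
  have h : IsPathConnected (({p}ᶜ : Set M)) := by
    refine Literature.AlgebraicTopology.Homotopy.isPathConnected_compl_singleton_of_chartedSpace
      (E := EuclideanSpace ℝ (Fin n)) ?_ p
    rw [finrank_euclideanSpace_fin]
    omega
  haveI := isPathConnected_iff_pathConnectedSpace.mp h
  infer_instance

/-- `M ∖ {p}` is not compact for a compact Hausdorff topological `n`-manifold `M`, `n ≥ 1`: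
otherwise `{p}` would be open, i.e. `p` isolated, which does not happen in a manifold of
positive dimension. [folklore] -/
theorem noncompactSpace_compl_singleton_of_chartedSpace (hn : 1 ≤ n) (p : M) :
    NoncompactSpace ↥(({p}ᶜ : Set M)) := by
  rcases em (CompactSpace ↥(({p}ᶜ : Set M))) with hcs | hcs
  swap
  · exact not_compactSpace_iff.mp hcs
  exfalso
  have hc : IsCompact (({p}ᶜ : Set M)) := isCompact_iff_compactSpace.mpr hcs
  have hopen : IsOpen ({p} : Set M) := by
    rw [← compl_compl ({p} : Set M)]
    exact hc.isClosed.isOpen_compl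
  obtain ⟨i, hi, hi0⟩ :=
    Literature.AlgebraicTopology.Homotopy.exists_isOpenEmbedding_apply_zero_eq (E := EuclideanSpace ℝ (Fin n)) p
  have hpre : i ⁻¹' {p} = {0} := by
    ext v
    simp only [mem_preimage, mem_singleton_iff]
    rw [← hi0]
    exact hi.injective.eq_iff
  exact not_isOpen_singleton_euclidean hn (0 : EuclideanSpace ℝ (Fin n)) (hpre ▸ hopen.preimage hi.continuous)

end Punctured

section PuncturedHomology

variable {m : ℕ} {M : Type} [TopologicalSpace M] [T2Space M] [CompactSpace M]
  [ChartedSpace (EuclideanSpace ℝ (Fin (m + 1))) M] [PathConnectedSpace M]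

/-- **A punctured closed manifold with the homology of a sphere is acyclic** (concrete chain
model). Let `M : Type` be a compact Hausdorff path-connected topological `(m+1)`-manifold,
`m ≥ 1`, with `Hⱼ(M; ℤ) = 0` for `j ≠ 0, m + 1` and `Hₘ₊₁(M; ℤ) ≠ 0`. Then
`Hₖ(M ∖ {p}; ℤ) = 0` for every point `p` and every `k ≥ 1`. Proof VERBATIM that of
`HomotopySphere.isZero_csingularHomology_compl_singleton` (`PuncturedHomotopySphereHomology.lean`;
Kosinski 1993, VI §2; Hatcher 2002, §2.2, Prop. 3.29, §3.E): Mayer–Vietoris for the cover of `M`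
by `A = M ∖ {p}` and a chart ball `B ∋ p` with `A ∩ B ≃ Sᵐ`, the vanishing `Hⱼ(A; -) = 0` for
`j ≥ m + 1` of the connected non-compact manifold `A` (Prop. 3.29, with `ℤ` and `ℤ/d`
coefficients) and the Bockstein criterion in the torsion degree `k = m`; the homotopy
equivalence `M ≃ₕ Sᵐ⁺¹` used there enters only through `Hⱼ(M) ≅ Hⱼ(Sᵐ⁺¹)`, replaced here by the
two homological hypotheses. [cite: Kosinski1993, Ch. VI §2] [cite: HatcherAT2002, §2.2 p. 149 and Prop. 3.29] -/
theorem isZero_csingularHomology_compl_singleton_of_isZero (hm : 1 ≤ m)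
    (hM : ∀ j : ℕ, j ≠ 0 → j ≠ m + 1 →
      IsZero (Literature.AlgebraicTopology.SingularHomology.singularHomology ℤ ℤ M j))
    (hMtop : ¬ IsZero (Literature.AlgebraicTopology.SingularHomology.singularHomology ℤ ℤ M (m + 1)))
    (p : M) {k : ℕ} (hk : 1 ≤ k) :
    IsZero (Literature.AlgebraicTopology.SingularHomology.csingularHomology ℤ ℤ ↥(({p}ᶜ : Set M)) k) := by
  -- the chart ball `B = range i`, `i 0 = p`
  obtain ⟨i, hi, hi0⟩ :=
    Literature.AlgebraicTopology.Homotopy.exists_isOpenEmbedding_apply_zero_eq (E := EuclideanSpace ℝ (Fin (m + 1))) p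
  set A : Set M := {p}ᶜ with hAdef
  set B : Set M := range i with hBdef
  have hA : IsOpen A := isOpen_compl_singleton
  have hB : IsOpen B := hi.isOpen_range
  have hAB : A ∪ B = univ := by
    refine eq_univ_of_forall fun x => ?_
    by_cases hx : x = p
    · exact Or.inr ⟨0, hi0.trans hx.symm⟩
    · exact Or.inl hx
  -- instances on `A`
  haveI : ConnectedSpace A := connectedSpace_compl_singleton_of_chartedSpace (n := m + 1) (by omega) p
  haveI : NoncompactSpace A := noncompactSpace_compl_singleton_of_chartedSpace (n := m + 1) (by omega) p
  haveI : ChartedSpace (EuclideanSpace ℝ (Fin (m + 1))) A :=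
    inferInstanceAs (ChartedSpace (EuclideanSpace ℝ (Fin (m + 1))) (⟨{p}ᶜ, isOpen_compl_singleton⟩ : TopologicalSpace.Opens M))
  -- (1) `A ∪ B ≃ₜ M`
  let eU : ↥(A ∪ B) ≃ₜ M := (Homeomorph.setCongr hAB).trans (Homeomorph.Set.univ _)
  have isoU : ∀ j, Literature.AlgebraicTopology.SingularHomology.csingularHomology ℤ ℤ ↥(A ∪ B) j ≅
      Literature.AlgebraicTopology.SingularHomology.singularHomology ℤ ℤ M j :=
    fun j => Literature.AlgebraicTopology.SingularHomology.csingularHomology.mapIso ℤ ℤ eU j ≪≫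
      Literature.AlgebraicTopology.SingularHomology.csingularHomology.compIso ℤ ℤ _ j
  have hU0 : ∀ j, j ≠ 0 → j ≠ m + 1 →
      IsZero (Literature.AlgebraicTopology.SingularHomology.csingularHomology ℤ ℤ ↥(A ∪ B) j) :=
    fun j hj0 hj => (hM j hj0 hj).of_iso (isoU j)
  have hUtop : ¬ IsZero (Literature.AlgebraicTopology.SingularHomology.csingularHomology ℤ ℤ ↥(A ∪ B) (m + 1)) :=
    fun hz => hMtop (hz.of_iso (isoU (m + 1)).symm)
  -- (2) `B ≃ₜ ℝ^{m+1}` is contractible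
  let eB : ↥B ≃ₜ EuclideanSpace ℝ (Fin (m + 1)) := hi.isEmbedding.toHomeomorph.symm
  haveI : ContractibleSpace B := eB.contractibleSpace
  have hB0 : ∀ j, j ≠ 0 → IsZero (Literature.AlgebraicTopology.SingularHomology.csingularHomology ℤ ℤ B j) :=
    fun j hj => Literature.AlgebraicTopology.SingularHomology.isZero_csingularHomology_of_contractibleSpace ℤ ℤ hj
  -- (3) `A ∩ B ≃ₜ ℝ^{m+1} ∖ {0} ≃ₕ S^m`
  let eI₁ : ↥(A ∩ B) ≃ₜ ↥(Subtype.val ⁻¹' A : Set B) :=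
    (Homeomorph.setCongr (inter_comm A B)).trans
      (Literature.AlgebraicTopology.SingularHomology.preimageValHomeomorph B A).symm
  have heB : ∀ y : B, i (eB y) = (y : M) := fun y => by
    have h1 := congrArg Subtype.val (hi.isEmbedding.toHomeomorph.apply_symm_apply y)
    rwa [Topology.IsEmbedding.toHomeomorph_apply_coe] at h1
  let eI₂ : ↥(Subtype.val ⁻¹' A : Set B) ≃ₜ ↥(({0}ᶜ : Set (EuclideanSpace ℝ (Fin (m + 1))))) :=
    (eB.subtype (p := fun y : B => (y : ↥B) ∈ (Subtype.val ⁻¹' A : Set B))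
      (q := fun v : EuclideanSpace ℝ (Fin (m + 1)) => v ∈ (({0}ᶜ : Set (EuclideanSpace ℝ (Fin (m + 1)))))) fun y => by
        simp only [mem_preimage, hAdef, mem_compl_iff, mem_singleton_iff]
        rw [← heB y, ← hi0]
        exact hi.injective.ne_iff)
  let eI : ↥(A ∩ B) ≃ₕ Metric.sphere (0 : EuclideanSpace ℝ (Fin (m + 1))) 1 :=
    ((eI₁.trans eI₂).toHomotopyEquiv).trans (complZeroHomotopyEquivSphere m)
  have isoI : ∀ j, Literature.AlgebraicTopology.SingularHomology.csingularHomology ℤ ℤ ↥(A ∩ B) j ≅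
      Literature.AlgebraicTopology.SingularHomology.singularHomology ℤ ℤ (Metric.sphere (0 : EuclideanSpace ℝ (Fin (m + 1))) 1) j :=
    fun j => Literature.AlgebraicTopology.SingularHomology.csingularHomology.isoOfHomotopyEquiv ℤ ℤ eI j ≪≫
      Literature.AlgebraicTopology.SingularHomology.csingularHomology.compIso ℤ ℤ _ j
  have hI0 : ∀ j, j ≠ 0 → j ≠ m →
      IsZero (Literature.AlgebraicTopology.SingularHomology.csingularHomology ℤ ℤ ↥(A ∩ B) j) :=
    fun j hj0 hj =>
      (Literature.AlgebraicTopology.SingularHomology.isZero_singularHomology_sphere_holds ℤ ℤ hj0 hj).of_iso (isoI j)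
  have hItop : Nonempty (Literature.AlgebraicTopology.SingularHomology.csingularHomology ℤ ℤ ↥(A ∩ B) m ≅
      ModuleCat.of ℤ (ULift.{0} ℤ)) := by
    obtain ⟨e⟩ :=
      Literature.AlgebraicTopology.SingularHomology.nonempty_singularHomology_sphere_iso_holds ℤ ℤ (n := m) hm
    exact ⟨isoI m ≪≫ e⟩
  -- (4) `A` is a connected non-compact `(m+1)`-manifold: `H_j(A; -) = 0` for `j ≥ m + 1`
  have hAtop : ∀ j, m + 1 ≤ j →
      IsZero (Literature.AlgebraicTopology.SingularHomology.csingularHomology ℤ ℤ A j) :=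
    fun j hj =>
      Literature.AlgebraicTopology.SingularHomology.clocalHomology.isZero_csingularHomology_of_noncompact ℤ ℤ
        (n := m + 1) hj
  have hAZ : ∀ d : ℕ, 0 < d →
      IsZero (Literature.AlgebraicTopology.SingularHomology.csingularHomology ℤ (ZMod d) A (m + 1)) :=
    fun d _ =>
      Literature.AlgebraicTopology.SingularHomology.clocalHomology.isZero_csingularHomology_of_noncompact ℤ (ZMod d)
        (n := m + 1) le_rfl
  -- the degrees
  rcases lt_trichotomy k m with hkm | rfl | hkm
  · -- `1 ≤ k < m`: plain Mayer–Vietoris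
    have hU : IsZero (Literature.AlgebraicTopology.SingularHomology.csingularHomology ℤ ℤ ↥(A ∪ B) k) :=
      hU0 k (by omega) (by omega)
    have hI : IsZero (Literature.AlgebraicTopology.SingularHomology.csingularHomology ℤ ℤ ↥(A ∩ B) k) :=
      hI0 k (by omega) (by omega)
    exact Literature.AlgebraicTopology.SingularHomology.isZero_csingularHomology_of_union_of_inter ℤ ℤ hA hB k hU hI
  · -- `k = m`: the torsion degree
    obtain ⟨hG⟩ := hItop
    exact isZero_csingularHomology_of_mayerVietoris_of_bockstein hA hB k
      (hU0 k (by omega) (by omega)) hG (hAtop (k + 1) le_rfl) (hB0 (k + 1) (by omega)) hUtop hAZ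
  · -- `k ≥ m + 1`: non-compact manifold
    exact hAtop k (by omega)

/-- **A punctured closed manifold with the homology of a sphere is acyclic** (Mathlib's singular
homology): for a compact Hausdorff path-connected topological `(m+1)`-manifold `M : Type`,
`m ≥ 1`, with `Hⱼ(M; ℤ) = 0` for `j ≠ 0, m + 1` and `Hₘ₊₁(M; ℤ) ≠ 0`, a point `p` and `k ≥ 1`,
`Hₖ(M ∖ {p}; ℤ) = 0`. (Kosinski 1993, VI §2; Hatcher 2002, §2.2 and Prop. 3.29.)
[cite: Kosinski1993, Ch. VI §2] [cite: HatcherAT2002, §2.2 p. 149 and Prop. 3.29] -/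
theorem isZero_singularHomology_compl_singleton_of_isZero (hm : 1 ≤ m)
    (hM : ∀ j : ℕ, j ≠ 0 → j ≠ m + 1 →
      IsZero (Literature.AlgebraicTopology.SingularHomology.singularHomology ℤ ℤ M j))
    (hMtop : ¬ IsZero (Literature.AlgebraicTopology.SingularHomology.singularHomology ℤ ℤ M (m + 1)))
    (p : M) {k : ℕ} (hk : 1 ≤ k) :
    IsZero (Literature.AlgebraicTopology.SingularHomology.singularHomology ℤ ℤ ↥(({p}ᶜ : Set M)) k) :=
  (isZero_csingularHomology_compl_singleton_of_isZero hm hM hMtop p hk).of_iso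
    (Literature.AlgebraicTopology.SingularHomology.csingularHomology.compIso ℤ ℤ _ k).symm

end PuncturedHomology

section SPC4

variable {M : Type} [TopologicalSpace M] [T2Space M] [CompactSpace M] [ChartedSpace (EuclideanSpace ℝ (Fin 4)) M]
  [SimplyConnectedSpace M]

/-- **A closed simply connected 4-manifold with `H₂ = 0` has the integral homology of `S⁴`**,
GIVEN Poincaré duality `H¹ ≅ H₃` (`hPD`, Hatcher Thm. 3.30): `H₁(M) = 0` (Hurewicz in degree one,
proved), `H₂(M) = 0` (hypothesis), `H₃(M) = 0` (`hPD` and `H¹ = 0`, proved: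
`isZero_singularHomology_of_poincareDuality_of_isZero_one`), `Hₖ(M) = 0` for `k ≥ 5`
(Thm. 3.26(c), proved). [cite: HatcherAT2002, Thm. 3.30, Thm. 3.26, Thm. 2A.1] -/
theorem isZero_singularHomology_of_ne_of_poincareDuality
    (hH₂ : IsZero (Literature.AlgebraicTopology.SingularHomology.singularHomology ℤ ℤ M 2))
    (hPD : ∀ μ : Literature.AlgebraicTopology.SingularHomology.HomologicalOrientation ℤ M 4,
      Literature.AlgebraicTopology.SingularHomology.bijective_poincareDualityMap μ (Nat.add_comm 1 3))
    {k : ℕ} (hk0 : k ≠ 0) (hk4 : k ≠ 4) :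
    IsZero (Literature.AlgebraicTopology.SingularHomology.singularHomology ℤ ℤ M k) := by
  obtain ⟨μ⟩ : Literature.AlgebraicTopology.SingularHomology.IsOrientableOver ℤ M 4 :=
    Literature.AlgebraicTopology.SingularHomology.isOrientableOver_int_of_simplyConnectedSpace_holds M
  have h1 : IsZero (Literature.AlgebraicTopology.SingularHomology.singularHomology ℤ ℤ M 1) :=
    Literature.AlgebraicTopology.SingularHomology.isZero_singularHomology_one_of_simplyConnectedSpace ℤ ℤ
  have h3 : IsZero (Literature.AlgebraicTopology.SingularHomology.singularHomology ℤ ℤ M 3) :=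
    isZero_singularHomology_of_poincareDuality_of_isZero_one (n := 3) μ (hPD μ) h1
  have hk1 : 1 ≤ k := Nat.pos_of_ne_zero hk0
  rcases Nat.lt_or_gt_of_ne hk4 with hk | hk
  · interval_cases k
    · exact h1
    · exact hH₂
    · exact h3
  · exact Literature.AlgebraicTopology.SingularHomology.isZero_singularHomology_of_lt_holds ℤ ℤ M 4 hk

omit [SimplyConnectedSpace M] in
/-- **`H₄(M; ℤ) ≠ 0` for a closed connected `ℤ`-orientable 4-manifold** (indeed `≅ ℤ`): the
collapse map of a coordinate ball is an isomorphism `H₄(M) ≅ H₄(S⁴) ≅ ℤ` (Hatcher 2002,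
Thm. 3.26(a) and the degree-one map, both proved in the tree: `exists_isFundamentalClass`,
`exists_isIso_map_sphere_of_isFundamentalClass`, `nonempty_singularHomology_sphere_iso_holds`).
[cite: HatcherAT2002, Thm. 3.26] -/
theorem not_isZero_singularHomology_four [ConnectedSpace M]
    (μ : Literature.AlgebraicTopology.SingularHomology.HomologicalOrientation ℤ M 4) :
    ¬ IsZero (Literature.AlgebraicTopology.SingularHomology.singularHomology ℤ ℤ M 4) := by
  obtain ⟨c, hc⟩ := Literature.AlgebraicTopology.SingularHomology.exists_isFundamentalClass μ
  obtain ⟨f, hf4⟩ :=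
    Literature.AlgebraicTopology.SingularHomology.exists_isIso_map_sphere_of_isFundamentalClass ℤ
      (n := 4) (by norm_num) μ hc
  obtain ⟨e⟩ :=
    Literature.AlgebraicTopology.SingularHomology.nonempty_singularHomology_sphere_iso_holds ℤ ℤ
      (n := 4) (by norm_num)
  intro hz
  have hz' : IsZero (ModuleCat.of ℤ (ULift.{0} ℤ)) :=
    hz.of_iso (e.symm ≪≫ (asIso (Literature.AlgebraicTopology.SingularHomology.singularHomology.map ℤ ℤ f 4)).symm)
  haveI := ModuleCat.subsingleton_of_isZero hz'
  exact absurd (Subsingleton.elim (ULift.up (1 : ℤ) : ULift.{0} ℤ) (ULift.up 0)) (by simp)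

/-- **The punctured manifold is contractible**, GIVEN Poincaré duality, Hurewicz and Milnor's CW
type. Let `M : Type` be a closed (compact, Hausdorff, second countable) simply connected
topological 4-manifold with `H₂(M; ℤ) = 0` and `p ∈ M`. Then `M ∖ {p}` is simply connected
(general position, proved) and acyclic (`isZero_singularHomology_compl_singleton_of_isZero`,
from step 1), so it is contractible by the Whitehead–Hurewicz recognition principle for
manifolds (`Manifold.contractibleSpace_of_simplyConnected_of_acyclic_of_hurewicz_of_cwType`:
Hurewicz `h432`, Hatcher Thm. 4.32; Milnor's CW type `hCW`, Milnor 1959 Cor. 1; Whitehead's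
contractibility criterion, PROVED in `WhiteheadCWContractible.lean`).
[cite: HatcherAT2002, Thm. 4.32 and Thm. 4.5] [cite: Milnor1959, Cor. 1] -/
theorem contractibleSpace_compl_singleton_of_hurewicz [SecondCountableTopology M]
    (hH₂ : IsZero (Literature.AlgebraicTopology.SingularHomology.singularHomology ℤ ℤ M 2))
    (hPD : ∀ μ : Literature.AlgebraicTopology.SingularHomology.HomologicalOrientation ℤ M 4,
      Literature.AlgebraicTopology.SingularHomology.bijective_poincareDualityMap μ (Nat.add_comm 1 3))
    (h432 : Literature.AlgebraicTopology.SingularHomology.hurewicz_iso.{0})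
    (hCW : Literature.AlgebraicTopology.Homotopy.Manifold.exists_cwComplex_homotopyEquiv.{0}) (p : M) :
    ContractibleSpace ↥(({p}ᶜ : Set M)) := by
  obtain ⟨μ⟩ : Literature.AlgebraicTopology.SingularHomology.IsOrientableOver ℤ M 4 :=
    Literature.AlgebraicTopology.SingularHomology.isOrientableOver_int_of_simplyConnectedSpace_holds M
  -- `M` has the homology of `S⁴`
  have hM : ∀ j : ℕ, j ≠ 0 → j ≠ 3 + 1 →
      IsZero (Literature.AlgebraicTopology.SingularHomology.singularHomology ℤ ℤ M j) :=
    fun j hj0 hj4 => isZero_singularHomology_of_ne_of_poincareDuality hH₂ hPD hj0 hj4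
  have hMtop : ¬ IsZero (Literature.AlgebraicTopology.SingularHomology.singularHomology ℤ ℤ M (3 + 1)) :=
    not_isZero_singularHomology_four μ
  -- `M ∖ {p}` is acyclic and simply connected
  have hac : ∀ k : ℕ, 1 ≤ k →
      IsZero (Literature.AlgebraicTopology.SingularHomology.singularHomology ℤ ℤ ↥(({p}ᶜ : Set M)) k) :=
    fun k hk => isZero_singularHomology_compl_singleton_of_isZero (m := 3) (by norm_num) hM hMtop p hk
  obtain ⟨i, hi, hi0⟩ :=
    Literature.AlgebraicTopology.Homotopy.exists_isOpenEmbedding_apply_zero_eq (E := EuclideanSpace ℝ (Fin 4)) p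
  haveI : SimplyConnectedSpace ↥(({p}ᶜ : Set M)) := by
    rw [← hi0]
    exact Literature.AlgebraicTopology.FundamentalGroupoid.isSimplyConnected_compl_singleton_of_isOpenEmbedding
      hi (by simp)
  -- Whitehead–Hurewicz for the open submanifold `M ∖ {p}`
  exact (Literature.AlgebraicTopology.Homotopy.Manifold.contractibleSpace_of_simplyConnected_of_acyclic_of_hurewicz_of_cwType
    h432 hCW).of_isOpen 4 isOpen_compl_singleton hac

/-- **(⇐) of `spc4.S10` from Poincaré duality, Hurewicz and Milnor's CW type.** A closed
(compact, Hausdorff, second countable) simply connected topological 4-manifold `M : Type` with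
`H₂(M; ℤ) = 0` is homotopy equivalent to `S⁴`: `M ∖ {p}` is contractible
(`contractibleSpace_compl_singleton_of_hurewicz`) and a Hausdorff space which is contractible
after deleting a point with a Euclidean neighbourhood is homotopy equivalent to the sphere
(`nonempty_homotopyEquiv_sphere_of_contractibleSpace_compl`, proved; Hatcher 2002, Example 0.10
and Prop. 0.17: `M` is the suspension of the chart sphere). (Freedman–Quinn 1990, §10.1 for the
statement.) [cite: HatcherAT2002, Thm. 4.32, Thm. 3.30, Example 0.10] [cite: Milnor1959, Cor. 1]
[cite: FreedmanQuinnPMS1990, §10.1] -/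
theorem nonempty_homotopyEquiv_sphere_four_of_hurewicz [SecondCountableTopology M]
    (hH₂ : IsZero (Literature.AlgebraicTopology.SingularHomology.singularHomology ℤ ℤ M 2))
    (hPD : ∀ μ : Literature.AlgebraicTopology.SingularHomology.HomologicalOrientation ℤ M 4,
      Literature.AlgebraicTopology.SingularHomology.bijective_poincareDualityMap μ (Nat.add_comm 1 3))
    (h432 : Literature.AlgebraicTopology.SingularHomology.hurewicz_iso.{0})
    (hCW : Literature.AlgebraicTopology.Homotopy.Manifold.exists_cwComplex_homotopyEquiv.{0}) :
    Nonempty (M ≃ₕ Metric.sphere (0 : EuclideanSpace ℝ (Fin 5)) 1) := by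
  obtain ⟨p⟩ : Nonempty M := inferInstance
  obtain ⟨i, hi, hi0⟩ :=
    Literature.AlgebraicTopology.Homotopy.exists_isOpenEmbedding_apply_zero_eq (E := EuclideanSpace ℝ (Fin 4)) p
  have hc : ContractibleSpace ↥(({i 0}ᶜ : Set M)) :=
    contractibleSpace_compl_singleton_of_hurewicz hH₂ hPD h432 hCW (i 0)
  exact Literature.AlgebraicTopology.Homotopy.nonempty_homotopyEquiv_sphere_of_contractibleSpace_compl hi hc

end SPC4

section Assembly

universe u

/-- **`spc4.S10` at universe `0` from Poincaré duality, Hurewicz and Milnor's CW type.** The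
characterisation `nonempty_homotopyEquiv_sphere_four_iff.{0}` — a closed topological 4-manifold
`M : Type` is homotopy equivalent to `S⁴` iff it is simply connected with `H₂(M; ℤ) = 0`
(Freedman–Quinn 1990, §10.1) — follows from the named facts `hPD` (Hatcher Thm. 3.30, only
`H¹ ≅ H₃` is used), `h432` (Hurewicz, Thm. 4.32) and `hCW` (Milnor 1959, Cor. 1); the direction
(⇒) is `simplyConnectedSpace_and_isZero_of_homotopyEquiv` (proved, `HomotopyS4Criterion.lean`).
[cite: FreedmanQuinnPMS1990, §10.1] [cite: HatcherAT2002, Thm. 3.30 and Thm. 4.32] [cite: Milnor1959, Cor. 1] -/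
theorem nonempty_homotopyEquiv_sphere_four_iff_of_hurewicz
    (hPD : ∀ (M : Type) [TopologicalSpace M] [CompactSpace M] [T2Space M] [ChartedSpace (EuclideanSpace ℝ (Fin 4)) M]
      (μ : Literature.AlgebraicTopology.SingularHomology.HomologicalOrientation ℤ M 4),
      Literature.AlgebraicTopology.SingularHomology.bijective_poincareDualityMap μ (Nat.add_comm 1 3))
    (h432 : Literature.AlgebraicTopology.SingularHomology.hurewicz_iso.{0})
    (hCW : Literature.AlgebraicTopology.Homotopy.Manifold.exists_cwComplex_homotopyEquiv.{0}) :
    nonempty_homotopyEquiv_sphere_four_iff.{0} := by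
  intro M _ _ _ _ _
  constructor
  · rintro ⟨e⟩
    exact simplyConnectedSpace_and_isZero_of_homotopyEquiv e
  · rintro ⟨hπ, hH₂⟩
    exact nonempty_homotopyEquiv_sphere_four_of_hurewicz hH₂ (@hPD M _ _ _ _) h432 hCW

/-- **`spc4.S10` at every universe from Poincaré duality, Hurewicz and Milnor's CW type**
(`nonempty_homotopyEquiv_sphere_four_iff_of_hurewicz` lifted by
`nonempty_homotopyEquiv_sphere_four_iff_of_univ_zero`). [cite: FreedmanQuinnPMS1990, §10.1]
[cite: HatcherAT2002, Thm. 3.30 and Thm. 4.32] [cite: Milnor1959, Cor. 1] -/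
theorem nonempty_homotopyEquiv_sphere_four_iff_of_hurewicz_univ
    (hPD : ∀ (M : Type) [TopologicalSpace M] [CompactSpace M] [T2Space M] [ChartedSpace (EuclideanSpace ℝ (Fin 4)) M]
      (μ : Literature.AlgebraicTopology.SingularHomology.HomologicalOrientation ℤ M 4),
      Literature.AlgebraicTopology.SingularHomology.bijective_poincareDualityMap μ (Nat.add_comm 1 3))
    (h432 : Literature.AlgebraicTopology.SingularHomology.hurewicz_iso.{0})
    (hCW : Literature.AlgebraicTopology.Homotopy.Manifold.exists_cwComplex_homotopyEquiv.{0}) :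
    nonempty_homotopyEquiv_sphere_four_iff.{u} :=
  nonempty_homotopyEquiv_sphere_four_iff_of_univ_zero
    (nonempty_homotopyEquiv_sphere_four_iff_of_hurewicz hPD h432 hCW)

end Assembly

end Literature.Topology.FourManifolds

end
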